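import Literature.NumberTheory.Automorphic.HarrisLanTaylorThorneCor627
import Literature.NumberTheory.GaloisRepresentations.FramedRepBlockSum
import Literature.NumberTheory.GaloisRepresentations.TateTwistFrobeniusProofs
import Literature.RepresentationTheory.Semisimple.Multiplicity
import Literature.RepresentationTheory.Semisimple.Twist
import Literature.RepresentationTheory.Semisimple.SubrepresentationEquiv
import HarnessLib

/-!
# `HLTTCor627SplitOrUnramified` from lang.S27: the leaf is implied by the crux it feeds
# (item stmt-Langlands-15020, support, rank 8; `--supports`, calibration)

The route item `IrreducibilityBySelfDuality.HLTTCor627SplitOrUnramified` is, verbatim, the named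
fact `Literature.NumberTheory.Automorphic.HarrisLanTaylorThorne2016.corollary627_splitOrUnramified`
(Harris–Lan–Taylor–Thorne 2016, Cor. 6.27 in the consequence form consumed by the proof of
Thm. 7.13: for `K` CM with an imaginary quadratic subfield `F₀` in which `p` splits, `n > 1`, `π`
cuspidal regular algebraic on `GL_n(𝔸_K)` and `ı : ℚ̄_p ≃ ℂ`, a family of continuous semisimple
`R_N : Γ_K → GL_{2n}(ℚ̄_p)`, `N ≥ N₀`, and `n`-element multisets `B_v` of non-zero `p`-adic numbers
with `R_N` unramified at every `v ∣ q`, `q ≠ p` split in `F₀` or unramified in `K`, `π`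
unramified above `q`, and `charpoly R_N(Frob_v^arith) = arithFrobPolyOfSatake ı q_v n α_v ·
∏_{b ∈ B_v} (X - b q_v^{-2N})`).  In the route it is leaf 1/4 of the crux
`GaloisRepOfRegularAlgebraic` = lang.S27 =
`Literature.NumberTheory.Automorphic.exists_galoisRep_of_regularAlgebraic` (the glue
`GaloisRepOfRegularAlgebraicOfLeaves` is landed).

This module proves the **converse direction of that glue for this leaf**, unconditionally in
the tree: lang.S27 implies the leaf,

  `corollary627_of_existsGaloisRep :
     exists_galoisRep_of_regularAlgebraic → HarrisLanTaylorThorne2016.corollary627_splitOrUnramified`,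

by the construction of the proof of HLTT Thm. 7.13 read backwards (p. 232: `R_{p,ı}(π, N)` has the
Frobenius eigenvalues of `r_{p,ı}(π)` together with `n` further eigenvalues scaled by
`ε_p^{-2N}`): given `r = r_{p,ı}(π) : Γ_K → GL_n(ℚ̄_p)` from lang.S27, put
`R_N := r ⊞ (𝟙_n ⊗ ε_p^{-2N})` (block sum with the Tate twist of the trivial rank-`n`
representation, relabelled to rank `2n`), `B_v := {1, …, 1}` and `N₀ := 0`.  Then `R_N` is
semisimple (block sum of a semisimple representation and a sum of characters), unramified at every
`v ∤ p` where `r` is (the cyclotomic character is unramified away from `p`,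
`FramedGaloisRep.isUnramifiedAt_cyclotomic_holds`), and its arithmetic Frobenius at such `v` has
characteristic polynomial `arithFrobPolyOfSatake ı q_v n α · (X - q_v^{-2N})^n`
(`ε_p(Frob_v^arith) = q_v`, `GaloisRep.cyclotomicCharacter_apply_of_isArithFrobAt`).  The
hypotheses on `F₀` and `q` of Cor. 6.27 are not needed for this direction.

Consequences recorded for the planner (see the item's notes): (i) the item is implied by a
published theorem stated in the tree's own vocabulary (HLTT Thm. A with Varma's local–global
compatibility, `exists_galoisRep_of_regularAlgebraic`), so it cannot be misstated-false — the
"arithmetic Frobenius / sign of the exponent" rendering worry of the item text is settled in the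
kernel; (ii) modulo the three other (landed or filed) leaves the item is *equivalent* to the crux
it serves, i.e. it is crux-strength formalization debt, not a routine support statement; (iii) a
second closure path: the item closes the day either `corollary627_splitOrUnramified_holds` or
`exists_galoisRep_of_regularAlgebraic_holds` lands (`corollary627_of_existsGaloisRep ‹_›`).

Library glue proved on the way (framed representations over a topological field `k`):
semisimplicity of `FramedRep.toContinuousRep` is preserved by block sums
(`isSemisimple_blockSum`, via the tree's `Representation.isSemisimpleRepresentation_prod`),
by relabelling (`isSemisimple_reindex`), by twisting (`isSemisimple_twist`), and holds for the
trivial representation (`isSemisimple_one`).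

This module is Theses-free (imports `Literature.*` only), so it may be imported by a closing
module of the route without creating an import cycle.

References: M. Harris, K.-W. Lan, R. Taylor, J. Thorne, *On the rigid cohomology of certain
Shimura varieties*, Res. Math. Sci. 3:37 (2016), Cor. 6.27 (p. 225), Thm. 7.13 and its proof
(p. 232). [HarrisLanTaylorThorneRMS2016]  J.-P. Serre, *Abelian ℓ-adic representations and
elliptic curves* (1968), Ch. I §1.2 (the cyclotomic character). [SerreAbelianLadic1968]
-/

noncomputable section

set_option linter.dupNamespace false -- project-wide option (lakefile weak.linter.dupNamespace); `Summit.Langlands.Langlands` is the mandated namespace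

open scoped NumberField Polynomial Matrix
open NumberField IsDedekindDomain Field Polynomial
open Literature.NumberTheory.GaloisRepresentations Literature.NumberTheory.Automorphic
open Literature.RepresentationTheory.Semisimple

namespace Summit.Langlands.Langlands.Theorems.HLTTCor627SplitOrUnramified

/-! ### Block-diagonal and relabelled matrices acting on vectors -/

section Matrices

variable {k : Type*} [CommRing k] {m n : ℕ}

/-- `diag(M, N)` acts on a concatenated vector `(x, y)` (indices relabelled along
`finSumFinEquiv`) by `(M x, N y)` (Mathlib `Matrix.fromBlocks_mulVec`,
`Matrix.submatrix_mulVec_equiv`). [folklore] -/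
theorem blockSumRingHom_mulVec (M : Matrix (Fin m) (Fin m) k) (N : Matrix (Fin n) (Fin n) k)
    (x : Fin m → k) (y : Fin n → k) :
    blockSumRingHom m n k (M, N) *ᵥ (Sum.elim x y ∘ ⇑finSumFinEquiv.symm) =
      Sum.elim (M *ᵥ x) (N *ᵥ y) ∘ ⇑finSumFinEquiv.symm := by
  rw [blockSumRingHom_apply, Matrix.reindex_apply, Matrix.submatrix_mulVec_equiv, Equiv.symm_symm,
    Function.comp_assoc, Equiv.symm_comp_self, Function.comp_id, Matrix.fromBlocks_mulVec]
  simp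

/-- A relabelled matrix acts on the relabelled vector by the relabelled image:
`(reindex e e M) (v ∘ e⁻¹) = (M v) ∘ e⁻¹` (Mathlib `Matrix.submatrix_mulVec_equiv`). [folklore] -/
theorem reindex_mulVec_comp_symm (e : Fin m ≃ Fin n) (M : Matrix (Fin m) (Fin m) k)
    (v : Fin m → k) :
    Matrix.reindex e e M *ᵥ (v ∘ ⇑e.symm) = (M *ᵥ v) ∘ ⇑e.symm := by
  rw [Matrix.reindex_apply, Matrix.submatrix_mulVec_equiv, Equiv.symm_symm, Function.comp_assoc,
    Equiv.symm_comp_self, Function.comp_id]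

end Matrices

/-! ### Semisimplicity of framed representations: block sums, relabelling, twists, `𝟙` -/

section Semisimple

variable {G : Type*} [Group G] [TopologicalSpace G] {k : Type*} [Field k] [TopologicalSpace k]
  [IsTopologicalRing k] {m n : ℕ}

/-- **Transport of semisimplicity along an equivariant linear isomorphism of the frames**: if
`e : kᵐ ≃ kⁿ` intertwines `ρ` and `ρ'` then `ρ` semisimple implies `ρ'` semisimple (the tree's
`Representation.isSemisimpleRepresentation_of_equiv`). [folklore] -/
theorem isSemisimple_of_linearEquiv {ρ : FramedRep G k m} {ρ' : FramedRep G k n}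
    (e : (Fin m → k) ≃ₗ[k] (Fin n → k))
    (he : ∀ (g : G) (v : Fin m → k),
      e (((ρ g : GL (Fin m) k) : Matrix (Fin m) (Fin m) k) *ᵥ v) =
        ((ρ' g : GL (Fin n) k) : Matrix (Fin n) (Fin n) k) *ᵥ e v)
    (h : ρ.toContinuousRep.IsSemisimple) : ρ'.toContinuousRep.IsSemisimple := by
  haveI : ρ.toRepresentation.IsSemisimpleRepresentation := h
  exact Representation.isSemisimpleRepresentation_of_equiv
    (Representation.Equiv.mk (ρ := ρ.toRepresentation) (σ := ρ'.toRepresentation) e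
      fun g => LinearMap.ext fun v => he g v)

/-- **A block sum of semisimple framed representations is semisimple**: `ρ₁ ⊞ ρ₂` is equivalent,
along the concatenation isomorphism `kᵐ × kⁿ ≃ k^{m+n}`, to the direct sum `ρ₁ ⊕ ρ₂`
(Mathlib `Representation.prod`), which is semisimple by the tree's
`Representation.isSemisimpleRepresentation_prod`.  Ref: Serre, *Linear representations of finite
groups*, §1.3–1.4. [folklore] -/
theorem isSemisimple_blockSum {ρ₁ : FramedRep G k m} {ρ₂ : FramedRep G k n}
    (h₁ : ρ₁.toContinuousRep.IsSemisimple) (h₂ : ρ₂.toContinuousRep.IsSemisimple) :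
    (ρ₁.blockSum ρ₂).toContinuousRep.IsSemisimple := by
  haveI : ρ₁.toRepresentation.IsSemisimpleRepresentation := h₁
  haveI : ρ₂.toRepresentation.IsSemisimpleRepresentation := h₂
  -- the concatenation isomorphism `kᵐ × kⁿ ≃ k^{m+n}`, `(x, y) ↦ (x, y) ∘ finSumFinEquiv⁻¹`
  let e : ((Fin m → k) × (Fin n → k)) ≃ₗ[k] (Fin (m + n) → k) :=
    (LinearEquiv.sumArrowLequivProdArrow (Fin m) (Fin n) k k).symm ≪≫ₗ
      LinearEquiv.funCongrLeft k k finSumFinEquiv.symm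
  have he : ∀ (g : G) (v : (Fin m → k) × (Fin n → k)),
      e ((ρ₁.toRepresentation.prod ρ₂.toRepresentation) g v) =
        (ρ₁.blockSum ρ₂).toRepresentation g (e v) := by
    rintro _ ⟨x, y⟩
    exact (blockSumRingHom_mulVec _ _ x y).symm
  exact Representation.isSemisimpleRepresentation_of_equiv
    (Representation.Equiv.mk (ρ := ρ₁.toRepresentation.prod ρ₂.toRepresentation)
      (σ := (ρ₁.blockSum ρ₂).toRepresentation) e fun g => LinearMap.ext fun v => he g v)

/-- **Relabelling preserves semisimplicity**: `ρ.reindex e` (`e : Fin m ≃ Fin n`, e.g. a rank cast)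
is equivalent to `ρ` along `v ↦ v ∘ e⁻¹`. [folklore] -/
theorem isSemisimple_reindex (e : Fin m ≃ Fin n) {ρ : FramedRep G k m}
    (h : ρ.toContinuousRep.IsSemisimple) : (ρ.reindex e).toContinuousRep.IsSemisimple :=
  isSemisimple_of_linearEquiv (LinearEquiv.funCongrLeft k k e.symm)
    (fun _ v => (reindex_mulVec_comp_symm e _ v).symm) h

/-- The representation on `kⁿ` underlying a twist `ρ ⊗ χ` is the twist of the underlying
representation (the tree's `Representation.twist`): `(ρ ⊗ χ)(g) v = χ(g) • ρ(g) v`. [folklore] -/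
theorem toRepresentation_twist (ρ : FramedRep G k n) (χ : G →ₜ* kˣ) :
    (ρ.twist χ).toRepresentation = Representation.twist ρ.toRepresentation (χ : G →* kˣ) := by
  refine MonoidHom.ext fun g => LinearMap.ext fun v => ?_
  rw [FramedRep.toRepresentation_apply_apply, FramedRep.coe_twist_apply, Matrix.smul_mulVec]
  rfl

/-- **Twisting by a continuous character preserves semisimplicity** (the subrepresentations of
`ρ ⊗ χ` and of `ρ` are the same subspaces; the tree's
`Representation.isSemisimpleRepresentation_twist_iff`). [folklore] -/
theorem isSemisimple_twist {ρ : FramedRep G k n} (χ : G →ₜ* kˣ)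
    (h : ρ.toContinuousRep.IsSemisimple) : (ρ.twist χ).toContinuousRep.IsSemisimple := by
  change (ρ.twist χ).toRepresentation.IsSemisimpleRepresentation
  rw [toRepresentation_twist]
  exact (Representation.isSemisimpleRepresentation_twist_iff ρ.toRepresentation _).mpr h

/-- **The trivial framed representation `𝟙_n : g ↦ 1` is semisimple**: its subrepresentations are
all the subspaces of `kⁿ`, a complemented lattice (every subspace of a vector space has a
complement). [folklore] -/
theorem isSemisimple_one : (1 : FramedRep G k n).toContinuousRep.IsSemisimple := by
  change ComplementedLattice (Subrepresentation (FramedRep.toRepresentation (1 : FramedRep G k n)))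
  let e : Subrepresentation (FramedRep.toRepresentation (1 : FramedRep G k n)) ≃o
      Submodule k (Fin n → k) :=
    { toFun := fun S => S.toSubmodule
      invFun := fun p => ⟨p, fun g v hv => by
        rw [FramedRep.toRepresentation_apply_apply, ContinuousMonoidHom.coe_one, Pi.one_apply,
          Units.val_one, Matrix.one_mulVec]
        exact hv⟩
      left_inv := fun _ => rfl
      right_inv := fun _ => rfl
      map_rel_iff' := Iff.rfl }
  exact e.complementedLattice_iff.mpr inferInstance

omit [IsTopologicalRing k] in
/-- The trivial framed representation has characteristic polynomial `(X - 1)^n` everywhere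
(Mathlib `Matrix.charpoly_one`). [folklore] -/
theorem charpoly_one (g : G) :
    FramedRep.charpoly (1 : FramedRep G k n) g =
      ((Multiset.replicate n (1 : k)).map fun b => X - C b).prod := by
  rw [Multiset.map_replicate, Multiset.prod_replicate, C_1, FramedRep.charpoly,
    ContinuousMonoidHom.coe_one, Pi.one_apply, Units.val_one, Matrix.charpoly_one, Fintype.card_fin]

end Semisimple

/-! ### The second block: the Tate twist `𝟙_n ⊗ ε_p^{-2N}` -/

section SecondBlock

variable {K : Type} [Field K] [NumberField K] {p : ℕ} [Fact p.Prime] {n : ℕ}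

omit [NumberField K] in
/-- The trivial framed Galois representation `𝟙_n` is unramified everywhere. [folklore] -/
theorem isUnramifiedAt_one (v : HeightOneSpectrum (𝓞 K)) :
    FramedGaloisRep.IsUnramifiedAt v (1 : FramedGaloisRep K (PadicAlgCl p) n) :=
  fun _ _ _ _ => rfl

omit [NumberField K] in
/-- The trivial framed Galois representation `𝟙_n` has Frobenius characteristic polynomial
`∏_{b ∈ {1,…,1}} (X - b) = (X - 1)^n` at every place. [folklore] -/
theorem hasFrobCharpolyAt_one (v : HeightOneSpectrum (𝓞 K)) :
    FramedGaloisRep.HasFrobCharpolyAt v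
      (((Multiset.replicate n (1 : PadicAlgCl p)).map fun b => X - C b).prod)
      (1 : FramedGaloisRep K (PadicAlgCl p) n) :=
  fun _ _ σ _ => charpoly_one σ

/-- **The second block `S_N = 𝟙_n ⊗ ε_p^{-2N}`.**  For every `N` there is a *semisimple* framed
Galois representation `S : Γ_K → GL_n(ℚ̄_p)` which at every finite place `v ∤ p` is unramified
with arithmetic-Frobenius characteristic polynomial `∏_{b ∈ {1,…,1}} (X - b · q_v^{-2N}) =
(X - q_v^{-2N})^n`: the twist of the trivial rank-`n` representation by the `(-2N)`-th power of the
`p`-adic cyclotomic character (`exists_cyclotomicCharacter_padicAlgCl_zpow`; unramified away from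
`p` with `ε_p(Frob_v^arith) = q_v`, Serre I-1.2).
[cite: SerreAbelianLadic1968, Ch. I §1.2 (Example: the cyclotomic character)] -/
theorem exists_secondBlock (n N : ℕ) :
    ∃ S : FramedGaloisRep K (PadicAlgCl p) n, S.toGaloisRep.IsSemisimple ∧
      ∀ v : HeightOneSpectrum (𝓞 K), ((p : ℕ) : 𝓞 K) ∉ v.asIdeal →
        S.IsUnramifiedAt v ∧
        S.HasFrobCharpolyAt v
          (((Multiset.replicate n (1 : PadicAlgCl p)).map fun b =>
            X - C (b * ((v.residueCard : PadicAlgCl p)⁻¹) ^ (2 * N))).prod) := by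
  obtain ⟨ε, hε⟩ := exists_cyclotomicCharacter_padicAlgCl_zpow K p (-((2 * N : ℕ) : ℤ))
  refine ⟨FramedRep.twist (1 : FramedGaloisRep K (PadicAlgCl p) n) ε,
    isSemisimple_twist ε isSemisimple_one, fun v hv => ⟨?_, ?_⟩⟩
  · exact FramedGaloisRep.isUnramifiedAt_twist (isUnramifiedAt_one v) fun 𝔓 h𝔓 σ hσ =>
      eq_one_of_mem_inertia_of_cyclotomic_zpow hε hv h𝔓 hσ
  · have h1 := hasFrobCharpolyAt_one (K := K) (p := p) (n := n) v
    have h := FramedGaloisRep.hasFrobCharpolyAt_twist_of_eq_prod h1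
      (χ := ε) (c := (v.residueCard : PadicAlgCl p) ^ (-((2 * N : ℕ) : ℤ)))
      fun 𝔓 h𝔓 σ hσ => coe_apply_of_isArithFrobAt_of_cyclotomic_zpow hε hv h𝔓 hσ
    have hc : (v.residueCard : PadicAlgCl p) ^ (-((2 * N : ℕ) : ℤ)) =
        ((v.residueCard : PadicAlgCl p)⁻¹) ^ (2 * N) := by
      rw [zpow_neg, zpow_natCast, inv_pow]
    have hP : ((Multiset.replicate n (1 : PadicAlgCl p)).map fun b =>
          X - C (b * ((v.residueCard : PadicAlgCl p)⁻¹) ^ (2 * N))) =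
        ((Multiset.replicate n (1 : PadicAlgCl p)).map fun b =>
          X - C ((v.residueCard : PadicAlgCl p) ^ (-((2 * N : ℕ) : ℤ)) * b)) := by
      refine Multiset.map_congr rfl fun b _ => ?_
      rw [hc, mul_comm]
    rw [hP]
    exact h

end SecondBlock

/-! ### lang.S27 implies the leaf -/

/-- **Harris–Lan–Taylor–Thorne's Cor. 6.27 (consequence form) from Thm. A.**  lang.S27
(`exists_galoisRep_of_regularAlgebraic`: for `K` totally real or CM and `π` cuspidal regular
algebraic on `GL_n(𝔸_K)`, a continuous semisimple `r = r_{p,ı}(π) : Γ_K → GL_n(ℚ̄_p)` unramified at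
every `v ∤ p` where `π` is, with `charpoly r(Frob_v^arith) = arithFrobPolyOfSatake ı q_v n α_v`)
implies the named fact `HarrisLanTaylorThorne2016.corollary627_splitOrUnramified` (= the route item
`IrreducibilityBySelfDuality.HLTTCor627SplitOrUnramified` verbatim): take
`R_N := r ⊞ (𝟙_n ⊗ ε_p^{-2N})` relabelled to rank `2n`, `B_v := {1,…,1}`, `N₀ := 0` — the shape of
`R_{p,ı}(π, N)` in the proof of HLTT Thm. 7.13 (p. 232), read backwards.  Conditional only on the
named fact it takes as hypothesis (`conditional-result`); with the landed glue
`GaloisRepOfRegularAlgebraic.of_leaves_of_weilTraces` it shows the leaf is crux-equivalent modulo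
the other three leaves.
[cite: HarrisLanTaylorThorneRMS2016, Cor. 6.27 (p. 225); proof of Thm. 7.13 (p. 232)] -/
theorem corollary627_of_existsGaloisRep (hA : exists_galoisRep_of_regularAlgebraic) :
    HarrisLanTaylorThorne2016.corollary627_splitOrUnramified := by
  intro n K _ _ hcpt p _ _hn hCM _F₀ _hF₀ _hp π hπ ι
  obtain ⟨r, hrss, hr⟩ := hA hcpt (Or.inr hCM) π hπ p ι
  have hp : p.Prime := Fact.out
  -- the second block, one for each `N`
  choose S hSss hS using fun N : ℕ => exists_secondBlock (K := K) (p := p) n N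
  -- the rank cast `n + n = 2 n`
  let e : Fin (n + n) ≃ Fin (2 * n) := finCongr (two_mul n).symm
  refine ⟨0, fun N => FramedRep.reindex e (r.blockSum (S N)), fun _ => Multiset.replicate n 1,
    fun N _ => ?_, fun v => ⟨Multiset.card_replicate n 1, ?_⟩, ?_⟩
  · -- semisimplicity
    exact isSemisimple_reindex e (isSemisimple_blockSum hrss (hSss N))
  · -- `0 ∉ {1,…,1}`
    rw [Multiset.mem_replicate]
    exact fun h => zero_ne_one h.2
  · intro q hq hqp _ _ v hqv α hα N _
    have hpv : ((p : ℕ) : 𝓞 K) ∉ v.asIdeal := natCast_not_mem_of_natCast_mem hq hp hqp hqv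
    obtain ⟨hru, hrc⟩ := hr v α hα hpv
    obtain ⟨hSu, hSc⟩ := hS N v hpv
    refine ⟨(FramedGaloisRep.isUnramifiedAt_reindex_iff v e _).2 (hru.blockSum hSu),
      (FramedGaloisRep.hasFrobCharpolyAt_reindex_iff v e _ _).2 (hrc.blockSum hSc)⟩

/-! ### The printed Thm. A (existence half) already implies the leaf -/

/-- **Cor. 6.27 (consequence form) from the existence half of Thm. A alone.**  The named fact
`HarrisLanTaylorThorne2016.theoremA_existence` (HLTT 2016, Thm. A p. 3 = Cor. 7.14 p. 232, as
printed: for `K` totally real or CM and `π` cuspidal regular algebraic, a continuous semisimple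
`r : Γ_K → GL_n(ℚ̄_p)` which is HLTT-compatible with `π` — unramified with
`charpoly r(Frob_v^arith) = arithFrobPolyOfSatake ı q_v n α_v` at every `v ∣ q` for every rational
prime `q ≠ p` above which `π` is unramified) implies the named fact
`HarrisLanTaylorThorne2016.corollary627_splitOrUnramified` (= the route item
`IrreducibilityBySelfDuality.HLTTCor627SplitOrUnramified` verbatim), by the same construction as
`corollary627_of_existsGaloisRep`: `R_N := r ⊞ (𝟙_n ⊗ ε_p^{-2N})` relabelled to rank `2n`,
`B_v := {1,…,1}`, `N₀ := 0`.  The hypotheses of Cor. 6.27 on `q` ("splits in `F₀` or is unramified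
in `K`") are simply dropped, Thm. A asking only that `π` be unramified above `q ≠ p` — so this
sharpens `corollary627_of_existsGaloisRep` (lang.S27 = Thm. A + Varma's Cor. 9.3,
`theoremA_existence_of`): Varma's theorem is not needed.  Together with the tree's
`HarrisLanTaylorThorne2016.theoremA_existence_of_leaves` (`ReciprocityGLnExistenceProofs`: Thm. A,
existence, from Cor. 6.27, strong quadratic base change and the archimedean clause) it records in
the kernel that the leaf is *exactly of the strength of the printed Thm. A (existence)* for CM
fields containing an imaginary quadratic field in which `p` splits: no discharge of the leaf can be
cheaper than a proof of Thm. A itself.  Conditional only on the named fact taken as hypothesis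
(`conditional-result`). [cite: HarrisLanTaylorThorneRMS2016, Thm. A (p. 3), Cor. 6.27 (p. 225),
Cor. 7.14 and the proof of Thm. 7.13 (p. 232)] -/
theorem corollary627_of_theoremA_existence (hA : HarrisLanTaylorThorne2016.theoremA_existence) :
    HarrisLanTaylorThorne2016.corollary627_splitOrUnramified := by
  intro n K _ _ hcpt p _ _hn hCM _F₀ _hF₀ _hp π hπ ι
  obtain ⟨r, hrss, hr⟩ := hA hcpt (Or.inr hCM) π hπ p ι
  have hp : p.Prime := Fact.out
  -- the second block, one for each `N`
  choose S hSss hS using fun N : ℕ => exists_secondBlock (K := K) (p := p) n N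
  -- the rank cast `n + n = 2 n`
  let e : Fin (n + n) ≃ Fin (2 * n) := finCongr (two_mul n).symm
  refine ⟨0, fun N => FramedRep.reindex e (r.blockSum (S N)), fun _ => Multiset.replicate n 1,
    fun N _ => ?_, fun v => ⟨Multiset.card_replicate n 1, ?_⟩, ?_⟩
  · -- semisimplicity
    exact isSemisimple_reindex e (isSemisimple_blockSum hrss (hSss N))
  · -- `0 ∉ {1,…,1}`
    rw [Multiset.mem_replicate]
    exact fun h => zero_ne_one h.2
  · intro q hq hqp _ hπq v hqv α hα N _
    have hpv : ((p : ℕ) : 𝓞 K) ∉ v.asIdeal := natCast_not_mem_of_natCast_mem hq hp hqp hqv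
    -- HLTT-compatibility of `r` at `v ∣ q`, `q ≠ p`, `π` unramified above `q`
    obtain ⟨hru, hrc⟩ := hr q hq hqp hπq v hqv α hα
    obtain ⟨hSu, hSc⟩ := hS N v hpv
    refine ⟨(FramedGaloisRep.isUnramifiedAt_reindex_iff v e _).2 (hru.blockSum hSu),
      (FramedGaloisRep.hasFrobCharpolyAt_reindex_iff v e _ _).2 (hrc.blockSum hSc)⟩

/-- The lang.S27 calibration `corollary627_of_existsGaloisRep` recovered from the sharper
`corollary627_of_theoremA_existence` through the tree's glue `theoremA_existence_of`
(lang.S27 ⟹ Thm. A, existence). [folklore] -/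
theorem corollary627_of_existsGaloisRep' (hA : exists_galoisRep_of_regularAlgebraic) :
    HarrisLanTaylorThorne2016.corollary627_splitOrUnramified :=
  corollary627_of_theoremA_existence (HarrisLanTaylorThorne2016.theoremA_existence_of hA)

end Summit.Langlands.Langlands.Theorems.HLTTCor627SplitOrUnramified
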